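import Mathlib
import HarnessLib
import Literature.NumberTheory.LFunctions.MertensFirstVonMangoldtLower
import Literature.NumberTheory.LFunctions.RosserSchoenfeldMertensFirstConstant

/-!
# RH-FREE — «nothing here bears on the truth of RH»: the harmonic second moments of `Λ`,
# `Σ_{n≤x} Λ(n)²/n = (log x)²/2 + O(log x)` and `Σ_{n≤x} Λ(n)²/n · log(x/n) = (log x)³/6 + O(log² x)`
# (Alpöge–Furman 2026, Lemma 5.1, eq. (5.5)), PROVED by partial summation from Mertens' first theorem

Topic `Literature/NumberTheory/LFunctions` (namespace `Literature.NumberTheory.LFunctions`; helpers in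
the sub-namespace `AlpogeFurman2026.Cheb`). PROOF LAYER, theorems only (no definition, no named fact,
net debt 0), cell `rh-columns/lit` (RH literature-typing tranche 1, unit `rh-lit-frontier-1` gen 3).
The source's Lemma 5.1 lists the Chebyshev–Mertens estimates feeding the prime side of its
second-moment computation; the tree had the first-order ones (`ψ(x) ≪ x`:
`MertensFirstUpper.psi_le_of_two_le`; Mertens `|Σ_{n≤x} Λ(n)/n − log x| ≤ 1 + log 2`:
`MertensFirstLower.abs_sum_vonMangoldt_div_floor_sub_log_le`) and only crude UPPER bounds
`Σ_{n≤N} Λ(n)²/n ≤ log N (log N + O(1))` (`RudnickSarnakNPrimeSums`, `LogFreeDensityTheorem14`) for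
the second moments. This file proves the two asymptotic formulas (5.5) with the printed error sizes.

## What the source prints (TeX v2 of record, `rh-crit/ah/src/AlpogeFurman2026_arXiv2608.13637v2.tex`, l. 382–393)

L. Alpöge, R. Furman, *More than two thirds of the zeros of the Riemann zeta function are simple and
on the critical line*, arXiv:2608.13637v2 (2026), UNREFEREED (D-0012) [key `AlpogeFurman2026`],
**Lemma 5.1** ("([MV07, §2.2])"): "For `x ≥ 2`, (5.4) `Σ_{n≤x} Λ(n) ≪ x`,
`Σ_{n≤x} Λ(n)/√n ≤ 3√x (x ≥ x₀)`, `Σ_{n≤x} Λ(n)/(√n log n) ≪ √x/log x`, `Σ_{n≤x} Λ(n)² ≪ x log x`;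
(5.5) `Σ_{n≤x} Λ(n)²/n = (log x)²/2 + O(log x)`, `Σ_{n≤x} (Λ(n)²/n)(log x − log n) = (log x)³/6 +
O((log x)²)`. (Each follows from `Σ_{n≤x} Λ(n)/n = log x + O(1)` by partial summation; see
[IK04, Theorem 2.7].)"

## What is proved here (OURS: the partial summation the source indicates, with one twist)

Write `A(t) = Σ_{n≤t} Λ(n)/n` (`|A(t) − log t| ≤ E₀ := 1 + log 2` for `t ≥ 1`, tree),
`T(x) = Σ_{n≤x} Λ(n) log n/n`, `S(x) = Σ_{n≤x} Λ(n)²/n`, `U(x) = Σ_{n≤x} (Λ(n)²/n) log(x/n)`.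

* §1 Abel summation (Mathlib `sum_mul_eq_sub_integral_mul₁`, `f = log`):
  `T(x) = A(x) log x − ∫_2^x A(t) dt/t`, hence `|T(x) − (log x)²/2| ≤ (3 + 2 log 2) log x` for
  `x ≥ 2` (`AlpogeFurman2026.Cheb.abs_sum_vonMangoldt_mul_log_div_sub_le`).
* §2 `S ≤ T` termwise (`Λ ≤ log`), and `T(x) − S(x) = Σ_{n≤x} Λ(n)(log n − Λ(n))/n ≤ log x · Σ_{n≤x,
  n not prime} Λ(n)/n ≤ P · log x` with the absolute constant `P = Σ_p (log p)/(p(p−1))` (tree: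
  `RosserSchoenfeld.sum_vonMangoldt_nonPrime_div_le`, `summable_vonMangoldt_nonPrime_div`) — the
  twist that avoids decomposing `Λ` over prime powers; so **(5.5), first formula**:
  `|S(x) − (log x)²/2| ≤ C log x` for `x ≥ 2` (`AlpogeFurman2026_sum_vonMangoldt_sq_div`, printed
  `O`-form; `AlpogeFurman2026.Cheb.abs_sum_vonMangoldt_sq_div_sub_le` with the constant
  `3 + 2 log 2 + P`).
* §3 Abel summation again (`c_n = Λ(n)²/n`): `U(x) = ∫_2^x S(t) dt/t` exactly, whence **(5.5), second
  formula**: `|U(x) − (log x)³/6| ≤ C (log x)²` for `x ≥ 2` (`AlpogeFurman2026_sum_vonMangoldt_sq_div_mul_log`).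

Sums are written over `n ∈ Finset.Icc 0 ⌊x⌋₊` (the terms `n = 0, 1` vanish), the indexing of
Mathlib's Abel summation. LABEL: RH-FREE literature (Chebyshev–Mertens elementary prime number
theory; a kernel proof verifies, asserts nothing on authority); nothing here bears on the truth of RH.

## References

* [AF26] L. Alpöge, R. Furman, arXiv:2608.13637v2 (2026), Lemma 5.1 (5.5), §5.1 p. 8.
  [key `AlpogeFurman2026`]
* [MV07] H. L. Montgomery, R. C. Vaughan, *Multiplicative Number Theory I*, CUP 2007, §2.2
  [key `MontgomeryVaughan2007`]; [IK04] H. Iwaniec, E. Kowalski, *Analytic Number Theory*, AMS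
  2004, Theorem 2.7 (the source's pointers for Lemma 5.1).
-/

noncomputable section

open MeasureTheory ArithmeticFunction

namespace Literature.NumberTheory.LFunctions

namespace AlpogeFurman2026.Cheb

/-! ## §0. The inputs: Mertens' first theorem and the prime-power tail -/

/-- Mertens with the Abel-summation indexing: `|Σ_{n ∈ [0,⌊t⌋]} Λ(n)/n − log t| ≤ 1 + log 2` for
`t ≥ 1` (tree: `MertensFirstLower.abs_sum_vonMangoldt_div_floor_sub_log_le`, the term `n = 0`
vanishing). [cite: AlpogeFurman2026, Lemma 5.1 ("`Σ_{n≤x} Λ(n)/n = log x + O(1)`")] -/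
theorem abs_sum_Icc_vonMangoldt_div_sub_log_le {t : ℝ} (ht : 1 ≤ t) :
    |∑ k ∈ Finset.Icc 0 ⌊t⌋₊, Λ k / (k : ℝ) - Real.log t| ≤ 1 + Real.log 2 := by
  have h := MertensFirstLower.abs_sum_vonMangoldt_div_floor_sub_log_le ht
  have hsplit : ∑ k ∈ Finset.Icc 0 ⌊t⌋₊, Λ k / (k : ℝ) = ∑ k ∈ Finset.Ioc 0 ⌊t⌋₊, Λ k / (k : ℝ) := by
    rw [Finset.Icc_eq_cons_Ioc (Nat.zero_le _), Finset.sum_cons]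
    simp
  rw [hsplit]
  exact h

/-- The prime-power tail: `0 ≤ Σ_{n ∈ [0,⌊t⌋], n not prime} Λ(n)/n ≤ P := Σ_n [n not prime] Λ(n)/n`
(`= Σ_p (log p)/(p(p−1))`, an absolute constant; tree:
`RosserSchoenfeld.sum_vonMangoldt_nonPrime_div_le`). [cite: AlpogeFurman2026, Lemma 5.1 (proof sketch)] -/
theorem sum_Icc_vonMangoldt_nonPrime_div_le (N : ℕ) :
    ∑ k ∈ Finset.Icc 0 N, (if k.Prime then 0 else (Λ k : ℝ)) / (k : ℝ) ≤
      ∑' n : ℕ, (if n.Prime then 0 else (Λ n : ℝ)) / (n : ℝ) := by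
  have hsub : ∑ k ∈ Finset.Ioc 1 N, (if k.Prime then 0 else (Λ k : ℝ)) / (k : ℝ) =
      ∑ k ∈ Finset.Icc 0 N, (if k.Prime then 0 else (Λ k : ℝ)) / (k : ℝ) := by
    refine Finset.sum_subset (fun k hk ↦ ?_) (fun k hk hk' ↦ ?_)
    · rw [Finset.mem_Ioc] at hk
      rw [Finset.mem_Icc]
      omega
    · rw [Finset.mem_Icc] at hk
      rw [Finset.mem_Ioc] at hk'
      have hk01 : k = 0 ∨ k = 1 := by omega
      rcases hk01 with rfl | rfl
      · simp
      · simp [Nat.not_prime_one, vonMangoldt_apply_one]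
  rw [← hsub]
  exact RosserSchoenfeld.sum_vonMangoldt_nonPrime_div_le N

/-! ## §1. `T(x) = Σ_{n≤x} Λ(n) log n / n = (log x)²/2 + O(log x)` -/

/-- `∫_2^x (log t)/t dt = ((log x)² − (log 2)²)/2` for `x ≥ 2`. [folklore] -/
private theorem integral_inv_mul_log {x : ℝ} (hx : 2 ≤ x) :
    ∫ t in Set.Ioc 2 x, t⁻¹ * Real.log t = (Real.log x ^ 2 - Real.log 2 ^ 2) / 2 := by
  rw [← intervalIntegral.integral_of_le hx]
  have hderiv : ∀ t ∈ Set.uIcc 2 x,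
      HasDerivAt (fun t : ℝ ↦ Real.log t ^ 2 / 2) (t⁻¹ * Real.log t) t := by
    intro t ht
    rw [Set.uIcc_of_le hx] at ht
    have ht0 : t ≠ 0 := by linarith [ht.1]
    have h := ((Real.hasDerivAt_log ht0).fun_pow 2).div_const 2
    simp only [Nat.cast_ofNat, show (2 : ℕ) - 1 = 1 from rfl, pow_one] at h
    exact h.congr_deriv (by ring)
  have hcont : ContinuousOn (fun t : ℝ ↦ t⁻¹ * Real.log t) (Set.uIcc 2 x) := by
    refine ContinuousOn.mul (continuousOn_inv₀.mono ?_) (Real.continuousOn_log.mono ?_) <;>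
    · intro t ht
      rw [Set.uIcc_of_le hx] at ht
      simp only [Set.mem_compl_iff, Set.mem_singleton_iff]
      linarith [ht.1]
  rw [intervalIntegral.integral_eq_sub_of_hasDerivAt hderiv (hcont.intervalIntegrable)]
  ring

/-- `∫_2^x (log t)²/(2t) dt = ((log x)³ − (log 2)³)/6` for `x ≥ 2`. [folklore] -/
private theorem integral_inv_mul_log_sq {x : ℝ} (hx : 2 ≤ x) :
    ∫ t in Set.Ioc 2 x, t⁻¹ * (Real.log t ^ 2 / 2) = (Real.log x ^ 3 - Real.log 2 ^ 3) / 6 := by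
  rw [← intervalIntegral.integral_of_le hx]
  have hderiv : ∀ t ∈ Set.uIcc 2 x,
      HasDerivAt (fun t : ℝ ↦ Real.log t ^ 3 / 6) (t⁻¹ * (Real.log t ^ 2 / 2)) t := by
    intro t ht
    rw [Set.uIcc_of_le hx] at ht
    have ht0 : t ≠ 0 := by linarith [ht.1]
    have h := ((Real.hasDerivAt_log ht0).fun_pow 3).div_const 6
    simp only [Nat.cast_ofNat, show (3 : ℕ) - 1 = 2 from rfl] at h
    exact h.congr_deriv (by ring)
  have hcont : ContinuousOn (fun t : ℝ ↦ t⁻¹ * (Real.log t ^ 2 / 2)) (Set.uIcc 2 x) := by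
    refine ContinuousOn.mul (continuousOn_inv₀.mono ?_)
      ((Real.continuousOn_log.mono ?_).pow 2 |>.div_const 2) <;>
    · intro t ht
      rw [Set.uIcc_of_le hx] at ht
      simp only [Set.mem_compl_iff, Set.mem_singleton_iff]
      linarith [ht.1]
  rw [intervalIntegral.integral_eq_sub_of_hasDerivAt hderiv (hcont.intervalIntegrable)]
  ring

/-- `t⁻¹` is integrable on `[2, x]`. [folklore] -/
private theorem integrableOn_inv_Icc (x : ℝ) : IntegrableOn (fun t : ℝ ↦ t⁻¹) (Set.Icc 2 x) := by
  refine (continuousOn_inv₀.mono ?_).integrableOn_Icc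
  intro t ht
  simp only [Set.mem_compl_iff, Set.mem_singleton_iff]
  linarith [ht.1]

/-- `t⁻¹ log t` is integrable on `[2, x]`. [folklore] -/
private theorem integrableOn_inv_mul_log_Icc (x : ℝ) :
    IntegrableOn (fun t : ℝ ↦ t⁻¹ * Real.log t) (Set.Icc 2 x) := by
  refine ContinuousOn.integrableOn_Icc ?_
  refine ContinuousOn.mul (continuousOn_inv₀.mono ?_) (Real.continuousOn_log.mono ?_) <;>
  · intro t ht
    simp only [Set.mem_compl_iff, Set.mem_singleton_iff]
    linarith [ht.1]

/-- **Abel summation against a step function that is `log t + O(1)`.** If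
`|B(t) − (log t)^m … |`: here in the form needed twice below — for a function `B` with
`|B(t) − g(t)| ≤ E` on `[2, x]` and both `t⁻¹ B`, `t⁻¹ g` integrable on `[2, x]`,
`|∫_2^x B(t) dt/t − ∫_2^x g(t) dt/t| ≤ E (log x − log 2)`. [folklore] -/
private theorem abs_integral_inv_mul_sub_le {x E : ℝ} (hx : 2 ≤ x) {B g : ℝ → ℝ}
    (hB : IntegrableOn (fun t ↦ t⁻¹ * B t) (Set.Ioc 2 x))
    (hg : IntegrableOn (fun t ↦ t⁻¹ * g t) (Set.Ioc 2 x))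
    (hE : ∀ t ∈ Set.Ioc 2 x, |B t - g t| ≤ E) :
    |(∫ t in Set.Ioc 2 x, t⁻¹ * B t) - ∫ t in Set.Ioc 2 x, t⁻¹ * g t| ≤
      E * (Real.log x - Real.log 2) := by
  rw [← integral_sub hB hg]
  have hbound : ∀ᵐ t ∂(volume.restrict (Set.Ioc 2 x)),
      ‖t⁻¹ * B t - t⁻¹ * g t‖ ≤ E * t⁻¹ := by
    refine ae_restrict_of_forall_mem measurableSet_Ioc fun t ht ↦ ?_
    have ht0 : 0 < t := by linarith [ht.1]
    rw [Real.norm_eq_abs, ← mul_sub, abs_mul, abs_of_pos (inv_pos.2 ht0), mul_comm]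
    exact mul_le_mul_of_nonneg_right (hE t ht) (inv_pos.2 ht0).le
  have hgi : Integrable (fun t : ℝ ↦ E * t⁻¹) (volume.restrict (Set.Ioc 2 x)) :=
    ((integrableOn_inv_Icc x).mono_set Set.Ioc_subset_Icc_self).const_mul E
  have h := norm_integral_le_of_norm_le hgi hbound
  rw [Real.norm_eq_abs] at h
  refine h.trans (le_of_eq ?_)
  rw [integral_const_mul, ← intervalIntegral.integral_of_le hx,
    integral_inv_of_pos (by norm_num) (by linarith), Real.log_div (by linarith) (by norm_num)]

/-- **`T(x) = (log x)²/2 + O(log x)`**: for `x ≥ 2`,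
`|Σ_{n≤x} Λ(n) log n / n − (log x)²/2| ≤ (3 + 2 log 2) log x` (Abel summation with `f = log`
against `A(t) = Σ_{n≤t} Λ(n)/n = log t + O(1)`).
[cite: AlpogeFurman2026, Lemma 5.1 (5.5) (proof: "by partial summation")] -/
theorem abs_sum_vonMangoldt_mul_log_div_sub_le {x : ℝ} (hx : 2 ≤ x) :
    |∑ k ∈ Finset.Icc 0 ⌊x⌋₊, Real.log k * (Λ k / (k : ℝ)) - Real.log x ^ 2 / 2| ≤
      (3 + 2 * Real.log 2) * Real.log x := by
  have hdiff : ∀ t ∈ Set.Icc 2 x, DifferentiableAt ℝ Real.log t :=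
    fun t ht ↦ Real.differentiableAt_log (by linarith [ht.1])
  have hint : IntegrableOn (deriv Real.log) (Set.Icc 2 x) := by
    rw [Real.deriv_log']
    exact integrableOn_inv_Icc x
  have habel := sum_mul_eq_sub_integral_mul₁ (fun k ↦ Λ k / (k : ℝ)) (by simp)
    (by simp [vonMangoldt_apply_one]) x hdiff hint
  simp only [Real.deriv_log] at habel
  -- Mertens for `A(t) = Σ_{n≤t} Λ(n)/n`
  have hAbound : ∀ t : ℝ, 1 ≤ t →
      |∑ k ∈ Finset.Icc 0 ⌊t⌋₊, Λ k / (k : ℝ) - Real.log t| ≤ 1 + Real.log 2 :=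
    fun t ht ↦ abs_sum_Icc_vonMangoldt_div_sub_log_le ht
  have hlog2 : 0 < Real.log 2 := Real.log_pos (by norm_num)
  have hlogx : Real.log 2 ≤ Real.log x := Real.log_le_log (by norm_num) hx
  have hlogx0 : 0 < Real.log x := hlog2.trans_le hlogx
  -- the integral term `∫_2^x A(t) dt/t = (log² x − log² 2)/2 + O(log x)`
  have hAint : IntegrableOn
      (fun t : ℝ ↦ t⁻¹ * ∑ k ∈ Finset.Icc 0 ⌊t⌋₊, Λ k / (k : ℝ)) (Set.Ioc 2 x) :=
    (integrableOn_mul_sum_Icc (fun k ↦ Λ k / (k : ℝ)) (by norm_num : (0 : ℝ) ≤ 2)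
      (integrableOn_inv_Icc x)).mono_set Set.Ioc_subset_Icc_self
  have hI := abs_integral_inv_mul_sub_le hx hAint
    ((integrableOn_inv_mul_log_Icc x).mono_set Set.Ioc_subset_Icc_self)
    (fun t ht ↦ hAbound t (by linarith [ht.1]))
  rw [integral_inv_mul_log hx] at hI
  have h1 := hAbound x (by linarith)
  rw [habel]
  -- from here on `A(x)` and the integral are two real numbers
  set A : ℝ := ∑ k ∈ Finset.Icc 0 ⌊x⌋₊, Λ k / (k : ℝ) with hA
  set J : ℝ := ∫ t in Set.Ioc 2 x, t⁻¹ * ∑ k ∈ Finset.Icc 0 ⌊t⌋₊, Λ k / (k : ℝ) with hJ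
  have h2 : |Real.log x * (A - Real.log x)| ≤ (1 + Real.log 2) * Real.log x := by
    rw [abs_mul, abs_of_pos hlogx0, mul_comm]
    exact mul_le_mul_of_nonneg_right h1 hlogx0.le
  have hsq : Real.log 2 ^ 2 / 2 ≤ Real.log 2 / 2 * Real.log x := by
    rw [sq]
    nlinarith
  have key : Real.log x * A - J - Real.log x ^ 2 / 2 =
      Real.log x * (A - Real.log x) + Real.log 2 ^ 2 / 2 -
        (J - (Real.log x ^ 2 - Real.log 2 ^ 2) / 2) := by ring
  rw [key]
  have e1 := abs_sub (Real.log x * (A - Real.log x) + Real.log 2 ^ 2 / 2)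
    (J - (Real.log x ^ 2 - Real.log 2 ^ 2) / 2)
  have e2 := abs_add_le (Real.log x * (A - Real.log x)) (Real.log 2 ^ 2 / 2)
  have e3 : |Real.log 2 ^ 2 / 2| = Real.log 2 ^ 2 / 2 := abs_of_pos (by positivity)
  have e4 : (1 + Real.log 2) * (Real.log x - Real.log 2) ≤ (1 + Real.log 2) * Real.log x := by
    nlinarith
  have hlog2' : Real.log 2 < 1 := by
    have := Real.log_lt_sub_one_of_pos (by norm_num : (0 : ℝ) < 2) (by norm_num)
    linarith
  have e5 : Real.log 2 * Real.log x ≤ Real.log x := by nlinarith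
  nlinarith [e1, e2, e3, e4, e5, h2, hI, hsq]

/-! ## §2. (5.5), first formula: `S(x) = Σ_{n≤x} Λ(n)²/n = (log x)²/2 + O(log x)` -/

/-- `S ≤ T` termwise: `Λ(n)²/n ≤ Λ(n) log n / n` (`Λ ≤ log`). [cite: AlpogeFurman2026, Lemma 5.1 (5.5)] -/
theorem sum_vonMangoldt_sq_div_le_sum_mul_log (N : ℕ) :
    ∑ k ∈ Finset.Icc 0 N, Λ k ^ 2 / (k : ℝ) ≤ ∑ k ∈ Finset.Icc 0 N, Real.log k * (Λ k / (k : ℝ)) := by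
  refine Finset.sum_le_sum fun k _ ↦ ?_
  rw [sq, mul_div_assoc]
  exact mul_le_mul_of_nonneg_right vonMangoldt_le_log
    (div_nonneg vonMangoldt_nonneg (Nat.cast_nonneg k))

/-- `T − S ≤ (log x) · (prime-power tail)`: `Σ_{n≤x} Λ(n)(log n − Λ(n))/n ≤ log x · Σ_{n≤x, n not
prime} Λ(n)/n`, since `log n − Λ(n)` vanishes at primes and is `≤ log n ≤ log x` otherwise.
[cite: AlpogeFurman2026, Lemma 5.1 (5.5)] -/
theorem sum_mul_log_sub_sum_sq_le {x : ℝ} (hx : 1 ≤ x) :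
    ∑ k ∈ Finset.Icc 0 ⌊x⌋₊, Real.log k * (Λ k / (k : ℝ)) - ∑ k ∈ Finset.Icc 0 ⌊x⌋₊, Λ k ^ 2 / (k : ℝ) ≤
      Real.log x * ∑ k ∈ Finset.Icc 0 ⌊x⌋₊, (if k.Prime then 0 else (Λ k : ℝ)) / (k : ℝ) := by
  rw [← Finset.sum_sub_distrib, Finset.mul_sum]
  refine Finset.sum_le_sum fun k hk ↦ ?_
  rw [Finset.mem_Icc] at hk
  by_cases hp : k.Prime
  · rw [vonMangoldt_apply_prime hp]
    simp [hp, sq, mul_div_assoc]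
  · rw [if_neg hp]
    have hkx : (k : ℝ) ≤ x := by
      have := Nat.floor_le (by linarith : (0 : ℝ) ≤ x)
      exact le_trans (by exact_mod_cast hk.2) this
    have hΛk : 0 ≤ Λ k / (k : ℝ) := div_nonneg vonMangoldt_nonneg (Nat.cast_nonneg k)
    rcases Nat.eq_zero_or_pos k with rfl | hkpos
    · simp
    · have hlogk : Real.log k ≤ Real.log x :=
        Real.log_le_log (by exact_mod_cast hkpos) hkx
      calc Real.log k * (Λ k / (k : ℝ)) - Λ k ^ 2 / (k : ℝ) = (Real.log k - Λ k) * (Λ k / (k : ℝ)) := by ring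
        _ ≤ Real.log x * (Λ k / (k : ℝ)) := by
            refine mul_le_mul_of_nonneg_right ?_ hΛk
            linarith [vonMangoldt_nonneg (n := k)]

/-- **[AF26] (5.5), first formula, explicit constant**: for `x ≥ 2`,
`|Σ_{n≤x} Λ(n)²/n − (log x)²/2| ≤ (3 + 2 log 2 + P) log x`, `P = Σ_{n not prime} Λ(n)/n
= Σ_p (log p)/(p(p−1))` (`= 0.7553…`). [cite: AlpogeFurman2026, Lemma 5.1 (5.5)] -/
theorem abs_sum_vonMangoldt_sq_div_sub_le {x : ℝ} (hx : 2 ≤ x) :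
    |∑ k ∈ Finset.Icc 0 ⌊x⌋₊, Λ k ^ 2 / (k : ℝ) - Real.log x ^ 2 / 2| ≤
      (3 + 2 * Real.log 2 + ∑' n : ℕ, (if n.Prime then 0 else (Λ n : ℝ)) / (n : ℝ)) * Real.log x := by
  set P : ℝ := ∑' n : ℕ, (if n.Prime then 0 else (Λ n : ℝ)) / (n : ℝ) with hP
  have hT := abs_sum_vonMangoldt_mul_log_div_sub_le hx
  have hST := sum_vonMangoldt_sq_div_le_sum_mul_log ⌊x⌋₊
  have hTS := sum_mul_log_sub_sum_sq_le (by linarith : (1 : ℝ) ≤ x)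
  have hPN := sum_Icc_vonMangoldt_nonPrime_div_le ⌊x⌋₊
  have hlogx0 : 0 < Real.log x := Real.log_pos (by linarith)
  have hTS' : ∑ k ∈ Finset.Icc 0 ⌊x⌋₊, Real.log k * (Λ k / (k : ℝ)) -
      ∑ k ∈ Finset.Icc 0 ⌊x⌋₊, Λ k ^ 2 / (k : ℝ) ≤ Real.log x * P :=
    hTS.trans (mul_le_mul_of_nonneg_left hPN hlogx0.le)
  have hP0 : 0 ≤ P := tsum_nonneg fun n ↦ by positivity [vonMangoldt_nonneg (n := n)]
  have hPL : 0 ≤ P * Real.log x := mul_nonneg hP0 hlogx0.le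
  rw [abs_le] at hT ⊢
  constructor
  · linarith [hT.1, hTS', hPL]
  · linarith [hT.2, hST, hPL]

end AlpogeFurman2026.Cheb

open AlpogeFurman2026.Cheb in
/-- **[AF26] Lemma 5.1, (5.5), first formula** ([MV07, §2.2]; [IK04, Thm 2.7]): for `x ≥ 2`,
`Σ_{n≤x} Λ(n)²/n = (log x)²/2 + O(log x)` — there is an absolute `C` with
`|Σ_{n≤x} Λ(n)²/n − (log x)²/2| ≤ C log x` for all real `x ≥ 2`
(`C = 3 + 2 log 2 + Σ_p (log p)/(p(p−1))` works: `AlpogeFurman2026.Cheb.abs_sum_vonMangoldt_sq_div_sub_le`).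
[cite: AlpogeFurman2026, Lemma 5.1 (5.5)] -/
theorem AlpogeFurman2026_sum_vonMangoldt_sq_div :
    ∃ C : ℝ, ∀ x : ℝ, 2 ≤ x →
      |∑ k ∈ Finset.Icc 0 ⌊x⌋₊, Λ k ^ 2 / (k : ℝ) - Real.log x ^ 2 / 2| ≤ C * Real.log x :=
  ⟨_, fun _ hx ↦ abs_sum_vonMangoldt_sq_div_sub_le hx⟩

/-! ## §3. (5.5), second formula: `Σ_{n≤x} (Λ(n)²/n) log(x/n) = (log x)³/6 + O(log² x)` -/

namespace AlpogeFurman2026.Cheb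

/-- **`U(x) = ∫_2^x S(t) dt/t`**: Abel summation with `c_n = Λ(n)²/n`, `f = log`, gives
`Σ_{n≤x} (Λ(n)²/n)(log x − log n) = ∫_2^x (Σ_{n≤t} Λ(n)²/n) dt/t` exactly.
[cite: AlpogeFurman2026, Lemma 5.1 (5.5) (proof: "by partial summation")] -/
theorem sum_vonMangoldt_sq_div_mul_log_eq_integral (x : ℝ) :
    ∑ k ∈ Finset.Icc 0 ⌊x⌋₊, Λ k ^ 2 / (k : ℝ) * (Real.log x - Real.log k) =
      ∫ t in Set.Ioc 2 x, t⁻¹ * ∑ k ∈ Finset.Icc 0 ⌊t⌋₊, Λ k ^ 2 / (k : ℝ) := by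
  have hdiff : ∀ t ∈ Set.Icc 2 x, DifferentiableAt ℝ Real.log t :=
    fun t ht ↦ Real.differentiableAt_log (by linarith [ht.1])
  have hint : IntegrableOn (deriv Real.log) (Set.Icc 2 x) := by
    rw [Real.deriv_log']
    exact integrableOn_inv_Icc x
  have habel := sum_mul_eq_sub_integral_mul₁ (fun k ↦ Λ k ^ 2 / (k : ℝ)) (by simp)
    (by simp [vonMangoldt_apply_one]) x hdiff hint
  simp only [Real.deriv_log] at habel
  have hsplit : ∑ k ∈ Finset.Icc 0 ⌊x⌋₊, Λ k ^ 2 / (k : ℝ) * (Real.log x - Real.log k) =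
      Real.log x * ∑ k ∈ Finset.Icc 0 ⌊x⌋₊, Λ k ^ 2 / (k : ℝ) -
        ∑ k ∈ Finset.Icc 0 ⌊x⌋₊, Real.log k * (Λ k ^ 2 / (k : ℝ)) := by
    rw [Finset.mul_sum, ← Finset.sum_sub_distrib]
    refine Finset.sum_congr rfl fun k _ ↦ ?_
    ring
  rw [hsplit, habel]
  ring

/-- **[AF26] (5.5), second formula, explicit constant**: for `x ≥ 2`,
`|Σ_{n≤x} (Λ(n)²/n)(log x − log n) − (log x)³/6| ≤ ((3 + 2 log 2 + P)/2 + 1) (log x)²`.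
[cite: AlpogeFurman2026, Lemma 5.1 (5.5)] -/
theorem abs_sum_vonMangoldt_sq_div_mul_log_sub_le {x : ℝ} (hx : 2 ≤ x) :
    |∑ k ∈ Finset.Icc 0 ⌊x⌋₊, Λ k ^ 2 / (k : ℝ) * (Real.log x - Real.log k) - Real.log x ^ 3 / 6| ≤
      ((3 + 2 * Real.log 2 + ∑' n : ℕ, (if n.Prime then 0 else (Λ n : ℝ)) / (n : ℝ)) + 1) *
        Real.log x ^ 2 := by
  set C : ℝ := 3 + 2 * Real.log 2 + ∑' n : ℕ, (if n.Prime then 0 else (Λ n : ℝ)) / (n : ℝ)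
    with hC
  have hlog2 : 0 < Real.log 2 := Real.log_pos (by norm_num)
  have hlog2' : Real.log 2 < 1 := by
    have := Real.log_lt_sub_one_of_pos (by norm_num : (0 : ℝ) < 2) (by norm_num)
    linarith
  have hlogx : Real.log 2 ≤ Real.log x := Real.log_le_log (by norm_num) hx
  have hlogx0 : 0 < Real.log x := hlog2.trans_le hlogx
  have hP0 : 0 ≤ ∑' n : ℕ, (if n.Prime then 0 else (Λ n : ℝ)) / (n : ℝ) :=
    tsum_nonneg fun n ↦ by positivity [vonMangoldt_nonneg (n := n)]
  have hC0 : 0 ≤ C := by rw [hC]; positivity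
  -- `S(t) = (log t)²/2 + O(log t)` on `(2, x]`, hence `|S(t) − (log t)²/2| ≤ C log x` there
  have hSbound : ∀ t ∈ Set.Ioc 2 x,
      |∑ k ∈ Finset.Icc 0 ⌊t⌋₊, Λ k ^ 2 / (k : ℝ) - Real.log t ^ 2 / 2| ≤ C * Real.log x := by
    intro t ht
    have h := abs_sum_vonMangoldt_sq_div_sub_le (le_of_lt ht.1)
    exact h.trans (mul_le_mul_of_nonneg_left (Real.log_le_log (by linarith [ht.1]) ht.2) hC0)
  have hSint : IntegrableOn
      (fun t : ℝ ↦ t⁻¹ * ∑ k ∈ Finset.Icc 0 ⌊t⌋₊, Λ k ^ 2 / (k : ℝ)) (Set.Ioc 2 x) :=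
    (integrableOn_mul_sum_Icc (fun k ↦ Λ k ^ 2 / (k : ℝ)) (by norm_num : (0 : ℝ) ≤ 2)
      (integrableOn_inv_Icc x)).mono_set Set.Ioc_subset_Icc_self
  have hgint : IntegrableOn (fun t : ℝ ↦ t⁻¹ * (Real.log t ^ 2 / 2)) (Set.Ioc 2 x) := by
    refine (ContinuousOn.integrableOn_Icc ?_).mono_set Set.Ioc_subset_Icc_self
    refine ContinuousOn.mul (continuousOn_inv₀.mono ?_)
      ((Real.continuousOn_log.mono ?_).pow 2 |>.div_const 2) <;>
    · intro t ht
      simp only [Set.mem_compl_iff, Set.mem_singleton_iff]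
      linarith [ht.1]
  have hI := abs_integral_inv_mul_sub_le hx hSint hgint hSbound
  rw [integral_inv_mul_log_sq hx] at hI
  rw [sum_vonMangoldt_sq_div_mul_log_eq_integral x]
  set J : ℝ := ∫ t in Set.Ioc 2 x, t⁻¹ * ∑ k ∈ Finset.Icc 0 ⌊t⌋₊, Λ k ^ 2 / (k : ℝ) with hJ
  -- assemble
  have key : J - Real.log x ^ 3 / 6 =
      (J - (Real.log x ^ 3 - Real.log 2 ^ 3) / 6) - Real.log 2 ^ 3 / 6 := by ring
  rw [key]
  have hcube : Real.log 2 ^ 3 / 6 ≤ Real.log x ^ 2 := by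
    have h1 : Real.log 2 ^ 3 ≤ Real.log 2 ^ 2 := by nlinarith
    have h2 : Real.log 2 ^ 2 ≤ Real.log x ^ 2 := by nlinarith
    nlinarith
  have e1 := abs_sub (J - (Real.log x ^ 3 - Real.log 2 ^ 3) / 6) (Real.log 2 ^ 3 / 6)
  have e2 : |Real.log 2 ^ 3 / 6| = Real.log 2 ^ 3 / 6 := abs_of_pos (by positivity)
  have e3 : C * Real.log x * (Real.log x - Real.log 2) ≤ C * Real.log x ^ 2 := by
    nlinarith [mul_nonneg (mul_nonneg hC0 hlogx0.le) hlog2.le]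
  nlinarith [e1, e2, e3, hI, hcube]

end AlpogeFurman2026.Cheb

open AlpogeFurman2026.Cheb in
/-- **[AF26] Lemma 5.1, (5.5), second formula** ([MV07, §2.2]; [IK04, Thm 2.7]): for `x ≥ 2`,
`Σ_{n≤x} (Λ(n)²/n)(log x − log n) = (log x)³/6 + O((log x)²)` — there is an absolute `C` with
`|Σ_{n≤x} (Λ(n)²/n)(log x − log n) − (log x)³/6| ≤ C (log x)²` for all real `x ≥ 2`.
[cite: AlpogeFurman2026, Lemma 5.1 (5.5)] -/
theorem AlpogeFurman2026_sum_vonMangoldt_sq_div_mul_log :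
    ∃ C : ℝ, ∀ x : ℝ, 2 ≤ x →
      |∑ k ∈ Finset.Icc 0 ⌊x⌋₊, Λ k ^ 2 / (k : ℝ) * (Real.log x - Real.log k) - Real.log x ^ 3 / 6| ≤
        C * Real.log x ^ 2 :=
  ⟨_, fun _ hx ↦ abs_sum_vonMangoldt_sq_div_mul_log_sub_le hx⟩

end Literature.NumberTheory.LFunctions

end
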